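import Summits.MatrixMultiplication.MatrixMultiplication.Theses.DefinableSTPPDichotomy
import Summits.MatrixMultiplication.MatrixMultiplication.Theorems.DefinableSTPPDichotomyHexagonClearanceRStubMassBound
import Summits.MatrixMultiplication.MatrixMultiplication.Theorems.DefinableSTPPDichotomyHexagonClearanceRStubShadowBound
import Summits.MatrixMultiplication.MatrixMultiplication.Theorems.DefinableSTPPDichotomyHexagonClearanceRStubNoLonelyOfAlg
import Literature.ModelTheory.PseudofiniteFields.DefinableTranslateRecurrenceLC
import Summits.MatrixMultiplication.MatrixMultiplication.Theorems.PairwiseCurvedTilingsLC.Negative.PairwiseCurvedTilingsLCShadowCounting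

/-!
# `DefinableSTPPDichotomy.HexagonClearanceR` from translate recurrence (stmt-MatrixMultiplication-17884)

The repaired seam `HexagonClearanceR` holds — VACUOUSLY — under the single named literature fact
`Literature.ModelTheory.PseudofiniteFields.DefinableTranslateRecurrenceLC` (translate recurrence for
definable sets over finite fields of large characteristic; Kiefe 1976 / CDM 1992 / Lang–Weil / uniform
Chebotarev), the same hypothesis under which the sibling crux `PairwiseCurvedTilingsLC` is refuted
(`Theorems/PairwiseCurvedTilingsLC/Negative/…FalseOfDefinableTranslateRecurrenceLC`).  Chain:

* `noLonely_of_definableTranslateRecurrenceLC` — recurrence with `c|A|² > |A|` pairs leaves a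
  non-diagonal pair: "no lonely generic point" (the hypothesis of the landed `stub_shadowBound_of_noLonely`);
* `stub_shadowBound_of_noLonely` (landed, p146882) — pattern `k = i` isolates translates, so big-`A` blocks have
  `B − C` shadow `≤ C₀|F|^{m−1}`;
* `stub_massBound_of_shadowBound` (landed, p147976) — three packings + block TPP + AM–GM: mass `≤ K|F|^m` for
  `ε ≤ 1/(m+1)`;
* `hexagonClearanceR_of_massBound` — the crux, vacuously: `ε₀ := 1/(m+1)`, characteristic threshold after `η`.
-/

set_option linter.dupNamespace false

namespace Summit.MatrixMultiplication.MatrixMultiplication.Theorems.HexagonClearanceR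

open Finset
open Summit.MatrixMultiplication.MatrixMultiplication.Theses.DefinableSTPPDichotomy
open Literature.ModelTheory.PseudofiniteFields

/-- **Translate recurrence ⇒ no lonely generic point.**  With `K' := max K ⌈1/c⌉`, a set `A` with
`|A| > K'` and `c|A|² ≤ #{(a₀,a) ∈ A² : t + a − a₀ ∈ T}` has such a pair off the diagonal (the
diagonal contributes only `|A| < c|A|²`). -/
theorem noLonely_of_definableTranslateRecurrenceLC (h : DefinableTranslateRecurrenceLC) :
    (∀ (m n n' : ℕ) (τ : FirstOrder.Language.ring.Formula (Fin m ⊕ Fin n))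
        (α : FirstOrder.Language.ring.Formula (Fin m ⊕ Fin n')),
        ∃ (K Q : ℕ) (C₀ : ℝ), ∀ (F : Type) [Field F] [Fintype F] [FirstOrder.Ring.CompatibleRing F],
        Q ≤ ringChar F → ∀ (y : Fin n → F), ∃ E : Finset (Fin m → F),
          (E.card : ℝ) ≤ C₀ * (Fintype.card F : ℝ) ^ ((m : ℝ) - 1) ∧
          ∀ (y' : Fin n' → F) (T A : Finset (Fin m → F)),
            (∀ w, w ∈ T ↔ τ.Realize (Sum.elim w y)) →
            (∀ v, v ∈ A ↔ α.Realize (Sum.elim v y')) →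
            K < A.card → ∀ t ∈ T, t ∉ E → ∃ a₀ ∈ A, ∃ a ∈ A, a ≠ a₀ ∧ t + a - a₀ ∈ T) := by
  classical
  intro m n n' τ α
  obtain ⟨Q, K, C, c, hc, hrec⟩ := h m n n' τ α
  refine ⟨max K (Nat.ceil (1 / c)), Q, C, ?_⟩
  intro F _ _ _ hQ y
  obtain ⟨E, hE, hE'⟩ := hrec F hQ y
  refine ⟨E, hE, ?_⟩
  intro y' T A hT hA hK t ht htE
  have hKA : K < A.card := lt_of_le_of_lt (le_max_left _ _) hK
  have hcount := hE' y' T A hT hA hKA t ht htE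
  by_contra hno
  push Not at hno
  have hsub : ((A ×ˢ A).filter fun p : (Fin m → F) × (Fin m → F) => t + p.2 - p.1 ∈ T) ⊆
      A.image fun a => (a, a) := by
    intro p hp
    obtain ⟨hp, hmem⟩ := Finset.mem_filter.1 hp
    obtain ⟨h1, h2⟩ := Finset.mem_product.1 hp
    have : p.2 = p.1 := by
      by_contra hne
      exact hno p.1 h1 p.2 h2 hne hmem
    exact Finset.mem_image.2 ⟨p.1, h1, Prod.ext rfl this.symm⟩
  have hle : (((A ×ˢ A).filter fun p : (Fin m → F) × (Fin m → F) => t + p.2 - p.1 ∈ T).card : ℝ) ≤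
      A.card := by
    exact_mod_cast (Finset.card_le_card hsub).trans Finset.card_image_le
  have hA0 : (0 : ℝ) < A.card := by exact_mod_cast lt_of_le_of_lt (Nat.zero_le _) hK
  have h1 : c * (A.card : ℝ) ≤ 1 := by
    have h' := hcount.trans hle
    rw [pow_two, ← mul_assoc] at h'
    exact le_of_mul_le_mul_right (by linarith) hA0
  have h2 : (Nat.ceil (1 / c) : ℝ) < A.card := by
    exact_mod_cast lt_of_le_of_lt (le_max_right _ _) hK
  have h3 : 1 / c ≤ (Nat.ceil (1 / c) : ℝ) := Nat.le_ceil _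
  have h4 : 1 / c < A.card := h3.trans_lt h2
  rw [div_lt_iff₀ hc] at h4
  linarith [mul_comm c (A.card : ℝ)]

/-- **Transfer: a uniform mass bound makes the crux vacuously true.**  Given, for the formulas, `K` and
`q₁` with `Σ_I (abc)^{(2+ε)/3} ≤ K·|F|^m` for all `0 < ε ≤ 1/(m+1)` in characteristic `≥ q₁`, take
`ε₀ := 1/(m+1)` and, after `η`, the threshold `max q₁ (max ⌈(max K 1 + 1)^{1/η}⌉ 2)`: then
`|F|^{m+η} ≤ mass ≤ K|F|^m < |F|^{m+η}`. -/
theorem hexagonClearanceR_of_massBound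
    (hM : (∀ (e m k : ℕ) (φI : FirstOrder.Language.ring.Formula (Fin e ⊕ Fin k))
        (φA φB φC : FirstOrder.Language.ring.Formula ((Fin e ⊕ Fin m) ⊕ Fin k)),
        ∃ (K : ℝ) (q₁ : ℕ), ∀ (F : Type) [Field F] [Fintype F] [FirstOrder.Ring.CompatibleRing F],
        q₁ ≤ ringChar F → ∀ (y : Fin k → F) (I : Finset (Fin e → F))
          (A B C : (Fin e → F) → Finset (Fin m → F)),
          (∀ x, x ∈ I ↔ φI.Realize (Sum.elim x y)) →
          (∀ x v, v ∈ A x ↔ φA.Realize (Sum.elim (Sum.elim x v) y)) →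
          (∀ x v, v ∈ B x ↔ φB.Realize (Sum.elim (Sum.elim x v) y)) →
          (∀ x v, v ∈ C x ↔ φC.Realize (Sum.elim (Sum.elim x v) y)) →
          (∀ i ∈ I, ∀ j ∈ I, ∀ k ∈ I, (i = j ∨ j = k ∨ k = i) → ∀ s ∈ A k, ∀ s' ∈ A i,
            ∀ t ∈ B i, ∀ t' ∈ B j, ∀ u ∈ C j, ∀ u' ∈ C k,
            (s' - s) + (t' - t) + (u' - u) = 0 → i = j ∧ j = k ∧ s = s' ∧ t = t' ∧ u = u') →
          ∀ ε : ℝ, 0 < ε → ε ≤ 1 / ((m : ℝ) + 1) →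
            ∑ x ∈ I, (((A x).card * (B x).card * (C x).card : ℕ) : ℝ) ^ ((2 + ε) / 3)
              ≤ K * (Fintype.card F : ℝ) ^ (m : ℝ))) :
    HexagonClearanceR := by
  intro e m k φI φA φB φC
  obtain ⟨K, q₁, hK⟩ := hM e m k φI φA φB φC
  have hm0 : (0 : ℝ) ≤ m := Nat.cast_nonneg m
  refine ⟨1 / ((m : ℝ) + 1), by positivity, ?_⟩
  intro ε η hε hεle hη
  set K' : ℝ := max K 1 with hK'def
  have hK'1 : (1 : ℝ) ≤ K' := le_max_right _ _
  have hK'0 : (0 : ℝ) < K' := lt_of_lt_of_le one_pos hK'1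
  set N : ℕ := Nat.ceil ((K' + 1) ^ (1 / η)) with hNdef
  refine ⟨max q₁ (max N 2), ?_⟩
  intro F instF instFin instCR hchar y I A B C hI hA hB hC hpair hmass
  exfalso
  have hcardF : max q₁ (max N 2) ≤ Fintype.card F :=
    hchar.trans (PairwiseCurvedTilingsLC.Negative.ringChar_le_card F)
  set q : ℝ := (Fintype.card F : ℝ) with hqdef
  have hq2 : (2 : ℝ) ≤ q := by
    rw [hqdef]; exact_mod_cast le_trans (le_max_right _ _) (le_trans (le_max_right _ _) hcardF)
  have hq0 : (0 : ℝ) < q := by linarith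
  have hKq : K' < q ^ η := by
    have h1 : (K' + 1) ^ (1 / η) ≤ q := by
      have : (N : ℝ) ≤ q := by
        rw [hqdef]; exact_mod_cast le_trans (le_max_left _ _) (le_trans (le_max_right _ _) hcardF)
      exact le_trans (Nat.le_ceil _) this
    have h2 : K' + 1 ≤ q ^ η := by
      calc K' + 1 = ((K' + 1) ^ (1 / η)) ^ η := by
            rw [← Real.rpow_mul (by positivity), one_div, inv_mul_cancel₀ hη.ne', Real.rpow_one]
        _ ≤ q ^ η := Real.rpow_le_rpow (by positivity) h1 hη.le
    linarith
  have hmassle := hK F (le_trans (le_max_left _ _) hchar) y I A B C hI hA hB hC hpair ε hε hεle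
  have hlt : K * q ^ (m : ℝ) < q ^ ((m : ℝ) + η) := by
    calc K * q ^ (m : ℝ) ≤ K' * q ^ (m : ℝ) :=
          mul_le_mul_of_nonneg_right (le_max_left _ _) (Real.rpow_nonneg hq0.le _)
      _ < q ^ η * q ^ (m : ℝ) := mul_lt_mul_of_pos_right hKq (Real.rpow_pos_of_pos hq0 _)
      _ = q ^ ((m : ℝ) + η) := by rw [Real.rpow_add hq0, mul_comm]
  exact absurd (hmass.trans hmassle) (not_le.2 hlt)

/-- **`HexagonClearanceR` under translate recurrence** (the route's single hinge: the sibling crux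
`PairwiseCurvedTilingsLC` is refuted under the same named fact).  The seam holds vacuously: recurrence ⇒
no lonely generic point ⇒ shadow bound on the big blocks ⇒ uniform mass bound ⇒ no family meets the
hypotheses for `ε ≤ 1/(m+1)` once `|F|^η` is large. -/
theorem HexagonClearanceR_of_definableTranslateRecurrenceLC (h : DefinableTranslateRecurrenceLC) :
    HexagonClearanceR :=
  hexagonClearanceR_of_massBound (stub_massBound_of_shadowBound
    (stub_shadowBound_of_noLonely (noLonely_of_definableTranslateRecurrenceLC h)))

end Summit.MatrixMultiplication.MatrixMultiplication.Theorems.HexagonClearanceR
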